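import Summits.MatrixMultiplication.OmegaCensus.STPPSmallPatternCyclicThreeAPFree

/-!
# ω-census, small patterns `(2,1,1)^k` / `(1,2,2)^k`: the SPLIT 3-AP-free host law — the parity bits moved off the cyclic factor

HONEST FRAMING (pub-omega census; verbatim): lottery ticket; floor = certified bounds/negative ranges.
Census STRUCTURE bookkeeping for column B5 (`T1`, `T2` host laws; seat pub-omega-stpp-3 gen 30); nothing here bears on `ω`
(thin patterns never beat the packing bound).

ENG2's cyclic 3-AP-free law (`STPPSmallPatternCyclicThreeAPFree.lean`) realises `(2,1,1)^k` in `ℤ/m` for `m ≥ 4F + 2` and `(1,2,2)^k`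
for `m ≥ 8F + 4` (`F = max f`, `f : Fin k → ℕ` injective with 3-AP-free range): the families `{2fᵢ, 2fᵢ+1} / {0} / {4fᵢ}` and
`{0} / {8fᵢ, 8fᵢ+2} / {4fᵢ, 4fᵢ+1}` spend a factor `2` resp. `4` of the modulus on ENCODING THE CHOICE BITS inside `ℤ/m`.  This file moves
the bits into a complementary subgroup: in ANY abelian group `G`, with `g, κ ∈ G` resp. `g, κ₁, κ₂ ∈ G`,

* `T1`: `Aᵢ = {fᵢ•g, fᵢ•g + κ}`, `Bᵢ = {0}`, `Cᵢ = {2fᵢ•g}` is an STPP family as soon as `c•g + a•κ = 0` with `|c| ≤ 2F`, `a ∈ {0, ±1}` forces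
  `c = a = 0` (`isSTPP_apSplitFam211`) — e.g. `G = ℤ/m × K`, `g = (1,0)`, `m ≥ 2F + 1`, `κ = (0,κ')` with `κ' ≠ 0`;
* `T2`: `Aᵢ = {0}`, `Bᵢ = {2fᵢ•g, 2fᵢ•g + κ₁}`, `Cᵢ = {fᵢ•g, fᵢ•g + κ₂}` is an STPP family as soon as `c•g + a•κ₁ + b•κ₂ = 0` with `|c| ≤ 2F`,
  `a, b ∈ {0, ±1}` forces `c = a = b = 0` (`isSTPP_apSplitFam122`) — e.g. `G = ℤ/m × K`, `m ≥ 2F + 1`, and `κ₁, κ₂ ∈ 0 × K` «sign-independent»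
  (`a κ₁ + b κ₂ = 0, a, b ∈ {0,±1} ⇒ a = b = 0`), which two basis vectors of ANY `ℤ/n₁ × ℤ/n₂` (`nᵢ ≥ 2`) or `1, 2 ∈ ℤ/n` (`n ≥ 4`) are.

The Def-5.1 word of the `T2` family is `(fⱼ + f_k − 2fᵢ)•g + a•κ₁ + b•κ₂`; the hypothesis kills all three coefficients, the vanishing integer
coefficient is a 3-term progression in the range of `f`, hence trivial.  So **the modulus threshold drops from `8F + 4` (cyclic `T2`) and `4F + 2`
(cyclic `T1`) to `2F + 1` on the cyclic factor**, at the price of a cofactor of order `≥ 4` (`T2`) resp. `≥ 2` (`T1`): for `m` EVEN these hosts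
(`ℤ/m × ℤ/2 × ℤ/2`, `ℤ/m × ℤ/4`, …; exponent `m` or `2m`, far below the cyclic ray) are NEW.  The independence hypothesis is a bounded, decidable
statement on the concrete seed type (`∀ c ∈ [−2F, 2F], ∀ a b ∈ {−1,0,1}, …`), so every seed-type instance is ONE `decide`; the generic
consequences for `G = ℤ/m × K` are proved here once (`exists_isSTPP_122pow_zmod_prod_of_threeAPFree`, `…211pow…`), with the rungs
`k = 17 … 24` (`2F + 1 = 101, 107, 115, 125, 141, 147, 163, 167`) spelled out for `K = ℤ/2 × ℤ/2`, `K = ℤ/n (n ≥ 4)` and (T1) `K = ℤ/2`.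
Census effect (desk, to be filed as seed files): the recurring residual class `ℤ/p × (ℤ/2)³`, `2p ≥ 2F + 1` (k = 21: p = 71, 73, 79, 81;
k = 22: 79, 81; k = 23: 83, 89, 97; k = 24: 89, 97), `ℤ/128 × ℤ/4` and `ℤ/128 × (ℤ/2)²` at `k = 19, 20`, `ℤ/23 × ℤ/5 × (ℤ/2)²` (k = 18, 19),
`ℤ/11 × ℤ/5 × (ℤ/2)³` (k = 18), `ℤ/59|61|67 × (ℤ/2)³` (k = 19) all host — search-free.

No sharpness claim anywhere.  References: H. Cohn, R. Kleinberg, B. Szegedy, C. Umans, FOCS 2005 (arXiv:math/0511460), Def. 5.1, Lemma 35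
(3-AP-free seeding); R. Salem, D. C. Spencer, Proc. Nat. Acad. Sci. 28 (1942) 561–563.
-/

open Literature.Computability.AlgebraicComplexity Finset

namespace Summit.MatrixMultiplication.OmegaCensus

section general

variable {G : Type*} [AddCommGroup G] [DecidableEq G]

/-! ## Pattern `(1,2,2)`: the split family in an arbitrary abelian group -/

/-- **The split 3-AP-free `(1,2,2)` family `Aᵢ = {0}`, `Bᵢ = {2fᵢ•g, 2fᵢ•g + κ₁}`, `Cᵢ = {fᵢ•g, fᵢ•g + κ₂}` is an STPP family** whenever `f` is injective
with 3-AP-free range, `fᵢ ≤ F`, and `c•g + a•κ₁ + b•κ₂ = 0` with `|c| ≤ 2F`, `a, b ∈ {−1, 0, 1}` forces `c = a = b = 0`.  The Def-5.1 word is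
`(fⱼ + f_k − 2fᵢ)•g + a•κ₁ + b•κ₂`. [cite: CohnKleinbergSzegedyUmans2005, Def. 5.1] -/
theorem isSTPP_apSplitFam122 {k : ℕ} (f : Fin k → ℕ) (hf : Function.Injective f) (hap : ThreeAPFree (Set.range f))
    (F : ℕ) (hF : ∀ i, f i ≤ F) (g κ₁ κ₂ : G)
    (hind : ∀ c a b : ℤ, -(2 * F : ℤ) ≤ c → c ≤ 2 * F → (a = -1 ∨ a = 0 ∨ a = 1) → (b = -1 ∨ b = 0 ∨ b = 1) →
      c • g + a • κ₁ + b • κ₂ = 0 → c = 0 ∧ a = 0 ∧ b = 0) :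
    IsSTPP (fun _ : Fin k => ({0} : Finset G))
      (fun i => ({(2 * (f i : ℤ)) • g, (2 * (f i : ℤ)) • g + κ₁} : Finset G))
      (fun i => ({(f i : ℤ) • g, (f i : ℤ) • g + κ₂} : Finset G)) := by
  intro i j l s hs s' hs' t ht t' ht' u hu u' hu' heq
  simp only [Finset.mem_insert, Finset.mem_singleton] at hs hs' ht ht' hu hu'
  -- choice bits as integers
  obtain ⟨e, he, rfl⟩ : ∃ e : ℤ, (e = 0 ∨ e = 1) ∧ t = (2 * (f i : ℤ)) • g + e • κ₁ := by
    rcases ht with rfl | rfl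
    · exact ⟨0, Or.inl rfl, by simp⟩
    · exact ⟨1, Or.inr rfl, by simp⟩
  obtain ⟨e', he', rfl⟩ : ∃ e' : ℤ, (e' = 0 ∨ e' = 1) ∧ t' = (2 * (f j : ℤ)) • g + e' • κ₁ := by
    rcases ht' with rfl | rfl
    · exact ⟨0, Or.inl rfl, by simp⟩
    · exact ⟨1, Or.inr rfl, by simp⟩
  obtain ⟨d, hd, rfl⟩ : ∃ d : ℤ, (d = 0 ∨ d = 1) ∧ u = (f j : ℤ) • g + d • κ₂ := by
    rcases hu with rfl | rfl
    · exact ⟨0, Or.inl rfl, by simp⟩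
    · exact ⟨1, Or.inr rfl, by simp⟩
  obtain ⟨d', hd', rfl⟩ : ∃ d' : ℤ, (d' = 0 ∨ d' = 1) ∧ u' = (f l : ℤ) • g + d' • κ₂ := by
    rcases hu' with rfl | rfl
    · exact ⟨0, Or.inl rfl, by simp⟩
    · exact ⟨1, Or.inr rfl, by simp⟩
  subst hs hs'
  have hw : ((f j : ℤ) + (f l : ℤ) - 2 * (f i : ℤ)) • g + (e' - e) • κ₁ + (d' - d) • κ₂ = 0 := by
    rw [← heq]; module
  have hFi := hF i; have hFj := hF j; have hFl := hF l
  obtain ⟨hc, ha, hb⟩ := hind _ _ _ (by omega) (by omega) (by omega) (by omega) hw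
  have hsum : f j + f l = f i + f i := by
    have : ((f j : ℤ) + (f l : ℤ)) = (f i : ℤ) + (f i : ℤ) := by linarith
    exact_mod_cast this
  have hji : f j = f i := hap (Set.mem_range_self j) (Set.mem_range_self i) (Set.mem_range_self l) hsum
  have hli : f l = f i := by omega
  have hji' : j = i := hf hji
  have hli' : l = i := hf hli
  subst hji' hli'
  refine ⟨rfl, rfl, rfl, ?_, ?_⟩
  · have : e = e' := by omega
    subst this; rfl
  · have : d = d' := by omega
    subst this; rfl

/-- **For every injective `f : Fin k → ℕ` with 3-AP-free range, `fᵢ ≤ F`, and `g, κ₁, κ₂ ∈ G` with the bounded independence property,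
`(1,2,2)^k ⊆ G`.** [cite: CohnKleinbergSzegedyUmans2005, Def. 5.1] -/
theorem exists_isSTPP_122pow_of_apSplit {k : ℕ} (f : Fin k → ℕ) (hf : Function.Injective f) (hap : ThreeAPFree (Set.range f))
    (F : ℕ) (hF : ∀ i, f i ≤ F) (g κ₁ κ₂ : G)
    (hind : ∀ c a b : ℤ, -(2 * F : ℤ) ≤ c → c ≤ 2 * F → (a = -1 ∨ a = 0 ∨ a = 1) → (b = -1 ∨ b = 0 ∨ b = 1) →
      c • g + a • κ₁ + b • κ₂ = 0 → c = 0 ∧ a = 0 ∧ b = 0) :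
    ∃ A B C : Fin k → Finset G, IsSTPP A B C ∧ ∀ i, (A i).card = 1 ∧ (B i).card = 2 ∧ (C i).card = 2 := by
  have hκ₁ : κ₁ ≠ 0 := by
    intro h0
    have := (hind 0 1 0 (by omega) (by omega) (by omega) (by omega) (by simp [h0])).2.1
    omega
  have hκ₂ : κ₂ ≠ 0 := by
    intro h0
    have := (hind 0 0 1 (by omega) (by omega) (by omega) (by omega) (by simp [h0])).2.2
    omega
  refine ⟨_, _, _, isSTPP_apSplitFam122 f hf hap F hF g κ₁ κ₂ hind, fun i => ⟨card_singleton _, ?_, ?_⟩⟩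
  · rw [card_insert_of_notMem (by simpa using hκ₁), card_singleton]
  · rw [card_insert_of_notMem (by simpa using hκ₂), card_singleton]

omit [DecidableEq G] in
/-- The bounded independence hypothesis from its `Finset` form (the form a concrete seed type decides in the kernel). -/
theorem apSplit_indep_of_finset (F : ℕ) (g κ₁ κ₂ : G)
    (h : ∀ c ∈ Finset.Icc (-(2 * F : ℤ)) (2 * F), ∀ a ∈ ({-1, 0, 1} : Finset ℤ), ∀ b ∈ ({-1, 0, 1} : Finset ℤ),
      c • g + a • κ₁ + b • κ₂ = 0 → c = 0 ∧ a = 0 ∧ b = 0) :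
    ∀ c a b : ℤ, -(2 * F : ℤ) ≤ c → c ≤ 2 * F → (a = -1 ∨ a = 0 ∨ a = 1) → (b = -1 ∨ b = 0 ∨ b = 1) →
      c • g + a • κ₁ + b • κ₂ = 0 → c = 0 ∧ a = 0 ∧ b = 0 := by
  intro c a b hc1 hc2 ha hb hw
  refine h c (Finset.mem_Icc.2 ⟨hc1, hc2⟩) a ?_ b ?_ hw
  · rcases ha with rfl | rfl | rfl <;> simp
  · rcases hb with rfl | rfl | rfl <;> simp

/-! ## Pattern `(2,1,1)`: the split family -/

/-- **The split 3-AP-free `(2,1,1)` family `Aᵢ = {fᵢ•g, fᵢ•g + κ}`, `Bᵢ = {0}`, `Cᵢ = {2fᵢ•g}` is an STPP family** whenever `f` is injective with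
3-AP-free range, `fᵢ ≤ F`, and `c•g + a•κ = 0` with `|c| ≤ 2F`, `a ∈ {−1, 0, 1}` forces `c = a = 0`.  The Def-5.1 word is
`(fᵢ + f_k − 2fⱼ)•g + a•κ`. [cite: CohnKleinbergSzegedyUmans2005, Def. 5.1] -/
theorem isSTPP_apSplitFam211 {k : ℕ} (f : Fin k → ℕ) (hf : Function.Injective f) (hap : ThreeAPFree (Set.range f))
    (F : ℕ) (hF : ∀ i, f i ≤ F) (g κ : G)
    (hind : ∀ c a : ℤ, -(2 * F : ℤ) ≤ c → c ≤ 2 * F → (a = -1 ∨ a = 0 ∨ a = 1) → c • g + a • κ = 0 → c = 0 ∧ a = 0) :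
    IsSTPP (fun i : Fin k => ({(f i : ℤ) • g, (f i : ℤ) • g + κ} : Finset G)) (fun _ => ({0} : Finset G))
      (fun i => ({(2 * (f i : ℤ)) • g} : Finset G)) := by
  intro i j l s hs s' hs' t ht t' ht' u hu u' hu' heq
  simp only [Finset.mem_insert, Finset.mem_singleton] at hs hs' ht ht' hu hu'
  obtain ⟨e, he, rfl⟩ : ∃ e : ℤ, (e = 0 ∨ e = 1) ∧ s = (f l : ℤ) • g + e • κ := by
    rcases hs with rfl | rfl
    · exact ⟨0, Or.inl rfl, by simp⟩
    · exact ⟨1, Or.inr rfl, by simp⟩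
  obtain ⟨e', he', rfl⟩ : ∃ e' : ℤ, (e' = 0 ∨ e' = 1) ∧ s' = (f i : ℤ) • g + e' • κ := by
    rcases hs' with rfl | rfl
    · exact ⟨0, Or.inl rfl, by simp⟩
    · exact ⟨1, Or.inr rfl, by simp⟩
  subst ht ht' hu hu'
  have hw : ((f i : ℤ) + (f l : ℤ) - 2 * (f j : ℤ)) • g + (e' - e) • κ = 0 := by
    rw [← heq]; module
  have hFi := hF i; have hFj := hF j; have hFl := hF l
  obtain ⟨hc, ha⟩ := hind _ _ (by omega) (by omega) (by omega) hw
  have hsum : f i + f l = f j + f j := by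
    have : ((f i : ℤ) + (f l : ℤ)) = (f j : ℤ) + (f j : ℤ) := by linarith
    exact_mod_cast this
  have hij : f i = f j := hap (Set.mem_range_self i) (Set.mem_range_self j) (Set.mem_range_self l) hsum
  have hlj : f l = f j := by omega
  have hij' : i = j := hf hij
  have hlj' : l = j := hf hlj
  subst hij' hlj'
  refine ⟨rfl, rfl, ?_, rfl, rfl⟩
  have : e = e' := by omega
  subst this; rfl

/-- **`(2,1,1)^k ⊆ G`** from the split family. [cite: CohnKleinbergSzegedyUmans2005, Def. 5.1] -/
theorem exists_isSTPP_211pow_of_apSplit {k : ℕ} (f : Fin k → ℕ) (hf : Function.Injective f) (hap : ThreeAPFree (Set.range f))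
    (F : ℕ) (hF : ∀ i, f i ≤ F) (g κ : G)
    (hind : ∀ c a : ℤ, -(2 * F : ℤ) ≤ c → c ≤ 2 * F → (a = -1 ∨ a = 0 ∨ a = 1) → c • g + a • κ = 0 → c = 0 ∧ a = 0) :
    ∃ A B C : Fin k → Finset G, IsSTPP A B C ∧ ∀ i, (A i).card = 2 ∧ (B i).card = 1 ∧ (C i).card = 1 := by
  have hκ : κ ≠ 0 := by
    intro h0
    have := (hind 0 1 (by omega) (by omega) (by omega) (by simp [h0])).2
    omega
  refine ⟨_, _, _, isSTPP_apSplitFam211 f hf hap F hF g κ hind, fun i => ⟨?_, card_singleton _, card_singleton _⟩⟩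
  rw [card_insert_of_notMem (by simpa using hκ), card_singleton]

omit [DecidableEq G] in
/-- The bounded `T1` independence hypothesis from its `Finset` form. -/
theorem apSplit_indep₁_of_finset (F : ℕ) (g κ : G)
    (h : ∀ c ∈ Finset.Icc (-(2 * F : ℤ)) (2 * F), ∀ a ∈ ({-1, 0, 1} : Finset ℤ), c • g + a • κ = 0 → c = 0 ∧ a = 0) :
    ∀ c a : ℤ, -(2 * F : ℤ) ≤ c → c ≤ 2 * F → (a = -1 ∨ a = 0 ∨ a = 1) → c • g + a • κ = 0 → c = 0 ∧ a = 0 := by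
  intro c a hc1 hc2 ha hw
  refine h c (Finset.mem_Icc.2 ⟨hc1, hc2⟩) a ?_ hw
  rcases ha with rfl | rfl | rfl <;> simp

end general

/-! ## The product form `G = ℤ/m × K`, `m ≥ 2F + 1` -/

section product

variable {K : Type*} [AddCommGroup K] [DecidableEq K]

omit [DecidableEq K] in
/-- In `ℤ/m × K` with `m ≥ 2F + 1`: `g = (1, 0)` and `κᵢ = (0, κᵢ')` satisfy the bounded `T2` independence as soon as `κ₁', κ₂'` are
«sign-independent» in `K` (`a κ₁' + b κ₂' = 0`, `a, b ∈ {0, ±1}` ⇒ `a = b = 0`). -/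
theorem apSplit_indep_prod (F m : ℕ) (hm : 2 * F + 1 ≤ m) (κ₁ κ₂ : K)
    (hκ : ∀ a b : ℤ, (a = -1 ∨ a = 0 ∨ a = 1) → (b = -1 ∨ b = 0 ∨ b = 1) → a • κ₁ + b • κ₂ = 0 → a = 0 ∧ b = 0) :
    ∀ c a b : ℤ, -(2 * F : ℤ) ≤ c → c ≤ 2 * F → (a = -1 ∨ a = 0 ∨ a = 1) → (b = -1 ∨ b = 0 ∨ b = 1) →
      c • ((1, 0) : ZMod m × K) + a • ((0, κ₁) : ZMod m × K) + b • ((0, κ₂) : ZMod m × K) = 0 → c = 0 ∧ a = 0 ∧ b = 0 := by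
  intro c a b hc1 hc2 ha hb hw
  have h1 := congrArg Prod.fst hw
  have h2 := congrArg Prod.snd hw
  simp only [Prod.fst_add, Prod.snd_add, Prod.smul_fst, Prod.smul_snd, smul_zero, add_zero, zero_add, Prod.fst_zero,
    Prod.snd_zero] at h1 h2
  obtain ⟨ra, rb⟩ := hκ a b ha hb h2
  refine ⟨?_, ra, rb⟩
  rw [zsmul_eq_mul, mul_one, ZMod.intCast_zmod_eq_zero_iff_dvd] at h1
  exact Int.eq_zero_of_dvd_of_natAbs_lt_natAbs h1 (by simp only [Int.natAbs_natCast]; omega)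

omit [DecidableEq K] in
/-- In `ℤ/m × K` with `m ≥ 2F + 1`: `g = (1, 0)`, `κ = (0, κ')` with `κ' ≠ 0` satisfy the bounded `T1` independence. -/
theorem apSplit_indep₁_prod (F m : ℕ) (hm : 2 * F + 1 ≤ m) (κ : K) (hκ : κ ≠ 0) :
    ∀ c a : ℤ, -(2 * F : ℤ) ≤ c → c ≤ 2 * F → (a = -1 ∨ a = 0 ∨ a = 1) →
      c • ((1, 0) : ZMod m × K) + a • ((0, κ) : ZMod m × K) = 0 → c = 0 ∧ a = 0 := by
  intro c a hc1 hc2 ha hw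
  have h1 := congrArg Prod.fst hw
  have h2 := congrArg Prod.snd hw
  simp only [Prod.fst_add, Prod.snd_add, Prod.smul_fst, Prod.smul_snd, smul_zero, add_zero, zero_add, Prod.fst_zero,
    Prod.snd_zero] at h1 h2
  refine ⟨?_, ?_⟩
  · rw [zsmul_eq_mul, mul_one, ZMod.intCast_zmod_eq_zero_iff_dvd] at h1
    exact Int.eq_zero_of_dvd_of_natAbs_lt_natAbs h1 (by simp only [Int.natAbs_natCast]; omega)
  · rcases ha with rfl | rfl | rfl
    · rw [neg_one_zsmul, neg_eq_zero] at h2; exact absurd h2 hκ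
    · rfl
    · rw [one_zsmul] at h2; exact absurd h2 hκ

/-- **`(1,2,2)^k ⊆ ℤ/m × K` for every `m ≥ 2F + 1`** and every `K` carrying two sign-independent elements (`f` injective, 3-AP-free range,
`fᵢ ≤ F`). [cite: CohnKleinbergSzegedyUmans2005, Def. 5.1] -/
theorem exists_isSTPP_122pow_zmod_prod_of_threeAPFree {k : ℕ} (f : Fin k → ℕ) (hf : Function.Injective f)
    (hap : ThreeAPFree (Set.range f)) (F : ℕ) (hF : ∀ i, f i ≤ F) (m : ℕ) (hm : 2 * F + 1 ≤ m) (κ₁ κ₂ : K)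
    (hκ : ∀ a b : ℤ, (a = -1 ∨ a = 0 ∨ a = 1) → (b = -1 ∨ b = 0 ∨ b = 1) → a • κ₁ + b • κ₂ = 0 → a = 0 ∧ b = 0) :
    ∃ A B C : Fin k → Finset (ZMod m × K), IsSTPP A B C ∧ ∀ i, (A i).card = 1 ∧ (B i).card = 2 ∧ (C i).card = 2 :=
  exists_isSTPP_122pow_of_apSplit f hf hap F hF _ _ _ (apSplit_indep_prod F m hm κ₁ κ₂ hκ)

/-- **`(2,1,1)^k ⊆ ℤ/m × K` for every `m ≥ 2F + 1`** and every `K` with a nonzero element. [cite: CohnKleinbergSzegedyUmans2005, Def. 5.1] -/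
theorem exists_isSTPP_211pow_zmod_prod_of_threeAPFree {k : ℕ} (f : Fin k → ℕ) (hf : Function.Injective f)
    (hap : ThreeAPFree (Set.range f)) (F : ℕ) (hF : ∀ i, f i ≤ F) (m : ℕ) (hm : 2 * F + 1 ≤ m) (κ : K) (hκ : κ ≠ 0) :
    ∃ A B C : Fin k → Finset (ZMod m × K), IsSTPP A B C ∧ ∀ i, (A i).card = 2 ∧ (B i).card = 1 ∧ (C i).card = 1 :=
  exists_isSTPP_211pow_of_apSplit f hf hap F hF _ _ (apSplit_indep₁_prod F m hm κ hκ)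

/-- An integer of absolute value `≤ 1` divisible by `n ≥ 2` is `0`. -/
theorem int_eq_zero_of_unit_dvd (n : ℕ) (hn : 2 ≤ n) (a : ℤ) (ha : a = -1 ∨ a = 0 ∨ a = 1) (h : (n : ℤ) ∣ a) : a = 0 := by
  rcases ha with rfl | rfl | rfl
  · have := Int.le_of_dvd one_pos (dvd_neg.1 h); omega
  · rfl
  · have := Int.le_of_dvd one_pos h; omega

/-- Two basis vectors of `ℤ/n₁ × ℤ/n₂` (`n₁, n₂ ≥ 2`) are sign-independent. -/
theorem signIndep_basis (n₁ n₂ : ℕ) (h₁ : 2 ≤ n₁) (h₂ : 2 ≤ n₂) :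
    ∀ a b : ℤ, (a = -1 ∨ a = 0 ∨ a = 1) → (b = -1 ∨ b = 0 ∨ b = 1) →
      a • ((1, 0) : ZMod n₁ × ZMod n₂) + b • ((0, 1) : ZMod n₁ × ZMod n₂) = 0 → a = 0 ∧ b = 0 := by
  intro a b ha hb h
  have ha0 := congrArg Prod.fst h
  have hb0 := congrArg Prod.snd h
  simp only [Prod.fst_add, Prod.snd_add, Prod.smul_fst, Prod.smul_snd, smul_zero, add_zero, zero_add, Prod.fst_zero,
    Prod.snd_zero] at ha0 hb0
  rw [zsmul_eq_mul, mul_one, ZMod.intCast_zmod_eq_zero_iff_dvd] at ha0 hb0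
  exact ⟨int_eq_zero_of_unit_dvd n₁ h₁ a ha ha0, int_eq_zero_of_unit_dvd n₂ h₂ b hb hb0⟩

/-- `1, 2 ∈ ℤ/n` (`n ≥ 4`) are sign-independent. -/
theorem signIndep_one_two (n : ℕ) (hn : 4 ≤ n) :
    ∀ a b : ℤ, (a = -1 ∨ a = 0 ∨ a = 1) → (b = -1 ∨ b = 0 ∨ b = 1) →
      a • (1 : ZMod n) + b • (2 : ZMod n) = 0 → a = 0 ∧ b = 0 := by
  intro a b ha hb h
  rw [zsmul_eq_mul, zsmul_eq_mul, mul_one] at h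
  have h' : (((a + b * 2 : ℤ)) : ZMod n) = 0 := by push_cast; exact h
  rw [ZMod.intCast_zmod_eq_zero_iff_dvd] at h'
  have hz : a + b * 2 = 0 :=
    Int.eq_zero_of_dvd_of_natAbs_lt_natAbs h' (by simp only [Int.natAbs_natCast]; omega)
  omega

end product

end Summit.MatrixMultiplication.OmegaCensus
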